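import Mathlib
import HarnessLib
import Summits.PneNP.PneNP.Theorems.CnfIdealGenLengthRankDefectRepresentationsAbsoluteMergePair
import Summits.PneNP.PneNP.Theorems.CnfIdealGenLengthRankDefectRepresentationsPolyOfAbsoluteMergeLevels

/-!
# The cut lemma in commutant form, and cuts of the generic union (crux `RankDefectRepresentations` = stmt-PneNP-18923,
# line `cell-union-merge`; lead g18)

Two basis-free tools for the lead stub `stub_absoluteMerge` (AMB), over ANY field:

* `exists_commutant_near` — **the one-union cut lemma in commutant form**: if `Q` is a complete orthogonal system of
  idempotents and `M` is any matrix with `rank [M, Q_B] ≤ c` for every union `Q_B`, then `M` is within rank `4c` of a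
  matrix commuting with every `Q_y` (adapted basis `…AbsoluteMergePair.toMatrix_collectedBasis_idempotent` + max-cut
  decomposition `…AbsoluteMergePair.exists_colourDiagonal_near`, which is `…CutLemma.exists_blockDiagonal_of_maxCut` at a
  maximising bipartition).
* `rank_comm_linearCombination_le` — **every linear combination `Q(λ) = ∑ λ_y Q_y` is cheap against every `P`-union**:
  if `rank [P_A, Q_B] ≤ c` for all unions `A, B` of two complete orthogonal systems, then `rank [P_A, Q(λ)] ≤ 8c` for
  every `λ : Y → K` and every `A` (write `P_A = G_A + L_A` with `G_A ∈ Comm(Q)`, `rank L_A ≤ 4c`).  Hence the GENERIC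
  union `∑ s_y Q_y` over the function field `K(s)` has all `P`-bipartition cuts `≤ 8c` — the input of the family cut lemma
  (memo `Cruxes/RankDefectRepresentations/Lines/cell-union-merge-g18.md` §3).

HONEST FRAMING: negative-lane tools; AMB stays open; P ≠ NP is not moved; F-N2 is a FRONTIER formal rung.
-/

set_option linter.dupNamespace false -- `Summit.PneNP.PneNP.…`: summit = sub-problem name (D-0017)

namespace Summit.PneNP.PneNP.Theorems.CnfIdealGenLengthRankDefectRepresentationsCommutantCutLemma

open Matrix Module
open Summit.PneNP.PneNP.Theorems.CnfIdealGenLengthRankDefectRepresentationsAbsoluteMergePair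
  (exists_colourDiagonal_near toMatrix_collectedBasis_idempotent rank_toMatrix_toLin' mul_diagonal_comm_of_offBlock_zero
    completeOrthogonalIdempotents_toLin' sum_diagonal_indicator)
open Summit.PneNP.PneNP.Theorems.CnfIdealGenLengthRankDefectRepresentationsPolyOfAbsoluteMergeLevels
  (rank_comm_symm rank_comm_perturb)
open Literature.Algebra.Module.KrullSchmidt (isInternal_range_of_completeOrthogonalIdempotents)

variable {K : Type} [Field K]

/-- Transport core: given a basis diagonalising every cell `Q_y` to the indicator of the `y`-th block, any matrix whose
commutators with all unions `Q_B` have rank `≤ c` is within rank `4c` of a matrix commuting with every `Q_y`. [folklore] -/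
theorem exists_commutant_near_of_basis {d : ℕ} {Y : Type} [Fintype Y] [DecidableEq Y] (n : Y → ℕ)
    (b : Basis (Σ y, Fin (n y)) K (Fin d → K))
    (M : Matrix (Fin d) (Fin d) K) (Q : Y → Matrix (Fin d) (Fin d) K) (c : ℕ)
    (hQb : ∀ y, LinearMap.toMatrix b b (Matrix.toLin' (Q y)) =
      Matrix.diagonal (fun i : Σ y, Fin (n y) => if i.1 = y then (1 : K) else 0))
    (hc : ∀ B : Finset Y, (M * (∑ y ∈ B, Q y) - (∑ y ∈ B, Q y) * M).rank ≤ c) :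
    ∃ G : Matrix (Fin d) (Fin d) K, (∀ y, G * Q y = Q y * G) ∧ (M - G).rank ≤ 4 * c := by
  have hmul : ∀ M N : Matrix (Fin d) (Fin d) K, LinearMap.toMatrix b b (Matrix.toLin' (M * N)) =
      LinearMap.toMatrix b b (Matrix.toLin' M) * LinearMap.toMatrix b b (Matrix.toLin' N) := by
    intro M N
    rw [Matrix.toLin'_mul, ← Module.End.mul_eq_comp, LinearMap.toMatrix_mul]
  have hsub : ∀ M N : Matrix (Fin d) (Fin d) K, LinearMap.toMatrix b b (Matrix.toLin' (M - N)) =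
      LinearMap.toMatrix b b (Matrix.toLin' M) - LinearMap.toMatrix b b (Matrix.toLin' N) := by
    intro M N
    rw [map_sub Matrix.toLin', map_sub (LinearMap.toMatrix b b)]
  have hQB : ∀ B : Finset Y, LinearMap.toMatrix b b (Matrix.toLin' (∑ y ∈ B, Q y)) =
      Matrix.diagonal (fun i : Σ y, Fin (n y) => if i.1 ∈ B then (1 : K) else 0) := by
    intro B
    rw [map_sum Matrix.toLin', map_sum (LinearMap.toMatrix b b), ← sum_diagonal_indicator n B]
    exact Finset.sum_congr rfl fun y _ => hQb y
  obtain ⟨F, hFM⟩ : ∃ F, LinearMap.toMatrix b b (Matrix.toLin' M) = F := ⟨_, rfl⟩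
  have hcF : ∀ B : Finset Y,
      (F * Matrix.diagonal (fun i : Σ y, Fin (n y) => if i.1 ∈ B then (1 : K) else 0) -
        Matrix.diagonal (fun i : Σ y, Fin (n y) => if i.1 ∈ B then (1 : K) else 0) * F).rank ≤ c := by
    intro B
    rw [← hQB B, ← hFM, ← hmul, ← hmul, ← hsub, rank_toMatrix_toLin']
    exact hc B
  obtain ⟨F₁, hF₁s, hF₁r⟩ := exists_colourDiagonal_near (fun i : Σ y, Fin (n y) => i.1) F c hcF
  obtain ⟨G, hG⟩ : ∃ G : Matrix (Fin d) (Fin d) K, LinearMap.toMatrix' (Matrix.toLin b b F₁) = G := ⟨_, rfl⟩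
  have hΦG : LinearMap.toMatrix b b (Matrix.toLin' G) = F₁ := by
    rw [← hG, Matrix.toLin'_toMatrix', LinearMap.toMatrix_toLin]
  have hinj : Function.Injective fun M : Matrix (Fin d) (Fin d) K => LinearMap.toMatrix b b (Matrix.toLin' M) :=
    (LinearMap.toMatrix b b).injective.comp Matrix.toLin'.injective
  refine ⟨G, fun y => ?_, ?_⟩
  · apply hinj
    show LinearMap.toMatrix b b (Matrix.toLin' (G * Q y)) = LinearMap.toMatrix b b (Matrix.toLin' (Q y * G))
    rw [hmul, hmul, hΦG, hQb y]
    exact mul_diagonal_comm_of_offBlock_zero n F₁ hF₁s (fun y' => if y' = y then (1 : K) else 0)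
  · rw [← rank_toMatrix_toLin' b, hsub, hΦG, hFM]
    exact hF₁r

/-- **The one-union cut lemma in commutant form.**  For a complete orthogonal system of idempotents `Q` and any
matrix `M` with `rank [M, Q_B] ≤ c` for every union `Q_B`, there is `G` commuting with every `Q_y` with
`rank (M − G) ≤ 4c`.  (Any field.) -/
theorem exists_commutant_near {d : ℕ} {Y : Type} [Fintype Y] [DecidableEq Y]
    (M : Matrix (Fin d) (Fin d) K) (Q : Y → Matrix (Fin d) (Fin d) K) (c : ℕ)
    (hQi : ∀ y, Q y * Q y = Q y) (hQo : ∀ y y', y ≠ y' → Q y * Q y' = 0) (hQs : ∑ y, Q y = 1)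
    (hc : ∀ B : Finset Y, (M * (∑ y ∈ B, Q y) - (∑ y ∈ B, Q y) * M).rank ≤ c) :
    ∃ G : Matrix (Fin d) (Fin d) K, (∀ y, G * Q y = Q y * G) ∧ (M - G).rank ≤ 4 * c := by
  have hq := completeOrthogonalIdempotents_toLin' Q hQi hQo hQs
  have hint : DirectSum.IsInternal fun y => LinearMap.range (Matrix.toLin' (Q y)) :=
    isInternal_range_of_completeOrthogonalIdempotents hq
  exact exists_commutant_near_of_basis
    (fun y => finrank K (LinearMap.range (Matrix.toLin' (Q y))))
    (hint.collectedBasis fun y => Module.finBasis K _) M Q c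
    (fun y => toMatrix_collectedBasis_idempotent hq hint _ y) hc

/-- Anything commuting with every cell commutes with every linear combination of cells. [folklore] -/
theorem comm_linearCombination {d : ℕ} {Y : Type} [Fintype Y] (Q : Y → Matrix (Fin d) (Fin d) K)
    (G : Matrix (Fin d) (Fin d) K) (hG : ∀ y, G * Q y = Q y * G) (lam : Y → K) :
    G * (∑ y, lam y • Q y) = (∑ y, lam y • Q y) * G := by
  rw [Finset.mul_sum, Finset.sum_mul]
  exact Finset.sum_congr rfl fun y _ => by rw [Matrix.mul_smul, Matrix.smul_mul, hG y]

/-- **Linear combinations of cells are cheap against every union of the other system.**  If two complete orthogonal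
systems `P, Q` have `rank [P_A, Q_B] ≤ c` for all unions, then `rank [P_A, ∑_y λ_y Q_y] ≤ 8c` for every `λ : Y → K` and
every `A ⊆ X`: the cut lemma in commutant form puts `P_A` within rank `4c` of the commutant of `Q`, which commutes with
`∑ λ_y Q_y` exactly.  (Any field; in particular over a function field `K(s)` the generic union `∑ s_y Q_y` has all
`P`-bipartition cuts `≤ 8c`.) -/
theorem rank_comm_linearCombination_le {d : ℕ} {X Y : Type} [Fintype Y] [DecidableEq Y]
    (P : X → Matrix (Fin d) (Fin d) K) (Q : Y → Matrix (Fin d) (Fin d) K) (c : ℕ)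
    (hQi : ∀ y, Q y * Q y = Q y) (hQo : ∀ y y', y ≠ y' → Q y * Q y' = 0) (hQs : ∑ y, Q y = 1)
    (hc : ∀ (A : Finset X) (B : Finset Y),
      ((∑ x ∈ A, P x) * (∑ y ∈ B, Q y) - (∑ y ∈ B, Q y) * (∑ x ∈ A, P x)).rank ≤ c)
    (A : Finset X) (lam : Y → K) :
    ((∑ x ∈ A, P x) * (∑ y, lam y • Q y) - (∑ y, lam y • Q y) * (∑ x ∈ A, P x)).rank ≤ 8 * c := by
  obtain ⟨G, hG, hr⟩ := exists_commutant_near (∑ x ∈ A, P x) Q c hQi hQo hQs (hc A)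
  have h0 : (G * (∑ y, lam y • Q y) - (∑ y, lam y • Q y) * G).rank = 0 := by
    rw [comm_linearCombination Q G hG lam, sub_self, Matrix.rank_zero]
  have := rank_comm_perturb G (∑ x ∈ A, P x) (∑ y, lam y • Q y)
  have h1 : (G - ∑ x ∈ A, P x).rank ≤ 4 * c := by
    rw [← neg_sub, Summit.PneNP.PneNP.Theorems.CnfIdealGenLengthRankDefectRepresentationsMergeLowerBound.rank_neg']
    exact hr
  omega

end Summit.PneNP.PneNP.Theorems.CnfIdealGenLengthRankDefectRepresentationsCommutantCutLemma
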